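import Summits.AnomalousDissipation.AnomalousDissipation.Theses.DwellLadder
import Summits.AnomalousDissipation.AnomalousDissipation.Theses.LoudWindows
import Summits.AnomalousDissipation.AnomalousDissipation.Theses.RootDecompCycle2B
import Summits.AnomalousDissipation.AnomalousDissipation.Theorems.RootDecompCycle2BWindowBookkeeping
import Literature.Analysis.FluidPDE.DoeringFoiasProofs
import Literature.Analysis.FluidPDE.DoeringFoiasPowerProofs
import Literature.Analysis.FluidPDE.DuchonRobertLionsEnergyEquality
import Literature.Analysis.FluidPDE.TimeAverageEnstrophy
import Literature.Analysis.FunctionSpaces.TorusTruncationH1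

/-!
# `DwellLadder.StretchFeeds` (stmt-AnomalousDissipation-30102) is a theorem — the 2B ⟶ LoudWindows junction

JUNCTION LEMMA: a ν-uniformly long loud stretch is a FED CASCADE WINDOW — `RootDecompCycle2B.LoudStretches` (2B's hinge 26351)
implies `LoudWindows.FedCascadeWindow` (lens-3's rung 24264): subsequence `j ↦ j + j₀(τ)`, floor `β := ε/2`, window
`T := T₀ + τ` with `τ := E₀/ε + 2048(E+1)²(‖f‖₂²+1)/ε³ + 1`; the injected power pays for the resolved dissipation on a finite
window (`timeMean_power_ge`: finite-time Leray–Hopf energy inequality from 0 + resolved ≤ total dissipation, the latter being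
`Theorems.WindowBookkeeping.timeMean_resolvedDissipation_le`, landed with item 26354).  Every ingredient is a tree lemma.
Source: decomp-ad cell, lens-1 g8 node «HorizonJunction» (kernel `run/shared/lean/pub/decomp-ad/decomp-ad-lens-1/HorizonJunction.lean`,
theorems `timeMean_power_ge` / `stretchFeeds_holds`, by name against the tree); landed by the cell's prover seat.  Nothing here proves the summit.
-/

set_option linter.dupNamespace false

noncomputable section

namespace Summit.AnomalousDissipation.AnomalousDissipation.Theorems.StretchFeeds

open MeasureTheory Filter Topology Set
open scoped InnerProductSpace
open Literature.Analysis.FunctionSpaces Literature.Analysis.FluidPDE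
open Summit.AnomalousDissipation.AnomalousDissipation.Theses
open Summit.AnomalousDissipation.AnomalousDissipation.Theorems.WindowBookkeeping

/-- Injected power pays for resolved dissipation on a finite window:
`⟨f·u⟩_T ≥ ⟨ν‖∇P_N u‖₂²⟩_T − (½‖u₀‖₂²)/T` (finite-time Leray–Hopf energy inequality from 0,
`Torus.IsLerayHopfOn.intervalIntegral_dissipation_le`, and resolved ≤ total). [folklore] -/
theorem timeMean_power_ge {ν : ℝ} (hν : 0 < ν)
    {f u₀ : UnitAddTorus (Fin 3) → EuclideanSpace ℝ (Fin 3)}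
    {u : ℝ → UnitAddTorus (Fin 3) → EuclideanSpace ℝ (Fin 3)}
    (hu : Torus.IsGlobalLerayHopf ν (fun _ => f) u₀ u) (N : ℕ) {T : ℝ} (hT : 0 < T) :
    timeMean (fun t => ν * (Torus.eGradNormSq (Torus.fourierTruncate N (u t))).toReal) T
        - Literature.Analysis.FunctionSpaces.Torus.kineticEnergy u₀ / T ≤
      timeMean (fun t => ∫ x, inner ℝ (f x) (u t x)) T := by
  have h1 := timeMean_resolvedDissipation_le hν.le hu N hT
  have h2 := (hu T hT).intervalIntegral_dissipation_le hT
  have hTi : 0 < T⁻¹ := inv_pos.2 hT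
  have h3 : T⁻¹ * ∫ t in (0:ℝ)..T, ν * (Torus.eGradNormSq (u t)).toReal ≤
      T⁻¹ * Literature.Analysis.FunctionSpaces.Torus.kineticEnergy u₀ +
        T⁻¹ * ∫ t in (0:ℝ)..T, ∫ x, inner ℝ (f x) (u t x) := by
    rw [← mul_add]; exact mul_le_mul_of_nonneg_left h2 hTi.le
  unfold timeMean at h1 ⊢
  rw [div_eq_inv_mul]
  linarith

/-- **Item 30102 `DwellLadder.StretchFeeds` holds** — THE JUNCTION LEMMA `LoudStretches → FedCascadeWindow` (subsequence
j ↦ j + j₀(τ), β := ε/2, window T := T₀ + τ with τ := E₀/ε + 2048(E+1)²(‖f‖₂²+1)/ε³ + 1). [folklore] -/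
theorem stretchFeeds_holds : DwellLadder.StretchFeeds := by
  rintro ⟨f, ν, E₀, E, ε, ⟨hf, hdiv, hmean, hν, hν0, hε⟩, hall⟩
  set c : ℝ := 256 * (E + 1) ^ 2 * ((∫ x, ‖f x‖ ^ 2) + 1) with hc
  have hf2 : 0 ≤ ∫ x, ‖f x‖ ^ 2 := integral_nonneg fun x => by positivity
  have hc0 : 0 ≤ c := by positivity
  have hε2 : 0 < (ε / 2) ^ 3 := by positivity
  set τ : ℝ := E₀ / ε + c / (ε / 2) ^ 3 + 1 with hτdef
  obtain ⟨j₀, hj⟩ := hall τ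
  have hj' : ∀ j : ℕ, ∃ T₀ : ℝ, 0 < T₀ ∧ ∃ (K : ℝ → ℕ)
      (u₀ : UnitAddTorus (Fin 3) → EuclideanSpace ℝ (Fin 3))
      (u : ℝ → UnitAddTorus (Fin 3) → EuclideanSpace ℝ (Fin 3)),
      ∫ x, ‖u₀ x‖ ^ 2 ≤ E₀ ∧ Torus.IsGlobalLerayHopf (ν (j + j₀)) (fun _ => f) u₀ u ∧
      ∀ T : ℝ, T₀ ≤ T → T ≤ T₀ + τ →
        timeMean (fun t => ∫ x, ‖u t x‖ ^ 2) T ≤ E ∧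
        ε ≤ timeMean (fun t => (ν (j + j₀)) *
          (Torus.eGradNormSq (Torus.fourierTruncate (K T) (u t))).toReal) T :=
    fun j => hj (j + j₀) (Nat.le_add_left j₀ j)
  choose T₀ hT₀ K u₀ u hcap hLH hwin using hj'
  refine ⟨f, hf, hdiv, hmean, fun j => ν (j + j₀), fun j => hν _,
    (tendsto_add_atTop_iff_nat j₀).2 hν0, E, ε / 2, by positivity, fun j => ?_⟩
  have hE₀ : 0 ≤ E₀ := le_trans (integral_nonneg fun x => by positivity) (hcap j)
  have hE₀ε : 0 ≤ E₀ / ε := div_nonneg hE₀ hε.le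
  have hcε : 0 ≤ c / (ε / 2) ^ 3 := div_nonneg hc0 hε2.le
  have hτE : E₀ / ε ≤ τ := by rw [hτdef]; linarith
  have hτc : c / (ε / 2) ^ 3 ≤ τ := by rw [hτdef]; linarith
  have hT0 : 0 < T₀ j + τ := by linarith [hT₀ j]
  have hTτ : τ ≤ T₀ j + τ := by linarith [hT₀ j]
  obtain ⟨hwinE, hwinD⟩ := hwin j (T₀ j + τ) (by linarith) le_rfl
  refine ⟨T₀ j + τ, ?_, u₀ j, u j, hLH j, hwinE, ?_⟩
  · have h1 : c ≤ τ * (ε / 2) ^ 3 := (div_le_iff₀ hε2).1 hτc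
    have h2 : τ * (ε / 2) ^ 3 ≤ (T₀ j + τ) * (ε / 2) ^ 3 :=
      mul_le_mul_of_nonneg_right hTτ hε2.le
    linarith
  · have hP := timeMean_power_ge (hν _) (hLH j) (K j (T₀ j + τ)) hT0
    have hKE : Literature.Analysis.FunctionSpaces.Torus.kineticEnergy (u₀ j) / (T₀ j + τ) ≤ ε / 2 := by
      rw [div_le_iff₀ hT0, Literature.Analysis.FunctionSpaces.Torus.kineticEnergy]
      have h1 : E₀ ≤ τ * ε := (div_le_iff₀ hε).1 hτE
      have h2 : τ * ε ≤ (T₀ j + τ) * ε := mul_le_mul_of_nonneg_right hTτ hε.le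
      linarith [hcap j]
    linarith


/-- Corollary (junction of the two lineages, by name): 2B's hinge `LoudStretches` (26351) implies the LoudWindows rung
`FedCascadeWindow` (24264). [folklore] -/
theorem fedCascadeWindow_of_loudStretches (h : RootDecompCycle2B.LoudStretches) : LoudWindows.FedCascadeWindow :=
  stretchFeeds_holds h

end Summit.AnomalousDissipation.AnomalousDissipation.Theorems.StretchFeeds

end
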